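import Summits.AtomisticToContinuum.Crystallization.Theorems.ChargedEnergyGapQuantisedSeams
import HarnessLib

/-!
# ChargedEnergyGap · NODE 73 «OctahedralLedger», part A (lens-3 g73): the leaf [MID-qᶠ] of the q-DESIGNATE cut beneath an octahedral ledger

The door pre-registered by critic row 1319: the mid-range truss leaf of the landed sixteen-leaf q-designate
`chargedEnergyGap_of_quantisedCascade_designate`,

  [MID-qᶠ] `MidTrussQ IsFccImage (3/5) (1/3) 3 (1/100) (3/100) 160 (2/5) 3 b₁ 80 (6/5) (3/2) (1/2) 0 (1/60000000) (1/2000000)`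
  («`½·springL + barMidL ≥ −c_T·shellMassL − cχ·transMassL − c_H·N` over the thirteen-binder quantised block, fcc class»),

is cut beneath FIVE pieces of three different natures, by a RE-SUMMATION OF THE TWO SITE FORMS OVER THE OCTAHEDRA OF THE REFERENCE (the
«octahedral ledger»: in the cubic fcc reference every nearest-neighbour ordered pair is an edge of exactly two octahedral-hole octahedra and every
second-neighbour ordered pair the diagonal of exactly one; numerically verified to `4e-13` on a periodic cell, `num/ledger_check.py`):

* (G) `CubicSelect IsFccImage (IsCubicFccImage (1921/2000) (977/1000))` — FIELD-FREE: a force-free, site-stress-free fcc-CLASS image (the class admits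
  the rhombohedral strains `27a²/50 ≤ h² ≤ 121a²/150`) IS a rigid copy of the CUBIC cell `h² = 2a²/3` with nearest-neighbour distance
  `a ∈ [0.9605, 0.977]` (the window CONTAINS the tree-certified one `8·491/5000 ≤ (a₀√2)⁶ ≤ 8·529/5000`, `Fcc.a0_pow_six_window`; `a₀√2 = 0.97123`).
  WEAKER (field-free consequence of three block binders) · DECIDABLE · ★ PROVED in part C from the tree's census-form scale certificate
  `Fcc.FccStressFreeScale` (`cubicSelect_of_fccStressFreeScale`), itself ⟸ `Fcc.FccScaleNumerics` (`Fcc.fccStressFreeScale_of_numerics`, landed;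
  the certificate is census-CERTIFIED, FSN38, and ALREADY load-bearing on the record path beneath [A-i]ᶠ) — so (G) costs the line NOTHING new.
* (L) `OctLedgerQ` — over the CUBIC class: every mid pair `(y,z)` (`6/5 < d ≤ 3/2`) spans a FRAMED regular octahedron of the reference with
  half-diagonal `ρ ∈ [0.679, 0.691]` (`IsFramedOct`), AND the ledger identity
  `κ₂·springL + barMidL = octPlateauL + octShellL + octCollarL` (the three octahedral functionals of §L2: clean octahedra with six equal weights,
  clean octahedra with unequal weights, octahedra meeting `X`).  WEAKER (pure bookkeeping + lattice geometry, no inequality content) · TRUE ·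
  ATTACKABLE-S (periodic re-summation `pres_repSystems_sum_eq` / `card_mul_sum_motif_eq_of_points_eq` + the cubic shell structure).
* (K₀) `OctPlateauQ` — over framed references: `0 ≤ octPlateauL`.  The CORE: on a clean octahedron the Volterra field of a quantised system is a
  COBOUNDARY (`volterraField_localExact_designate`, diameter `2ρ ≤ 1.382 < 10/3`), so the landed `octahedron_certificate` (`Σ_diag ℓ² ≤ 2·Σ_edge e²`)
  and `−½ ≤ c(2ρ) := V″(2ρ) − V′(2ρ)/(2ρ)` (`= −0.467` at `a₀`; `≥ −0.4987` on the window) give `κ₂Σe² + (c/2)Σℓ² ≥ (κ₂ − |c|)Σe² ≥ 0` octahedron by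
  octahedron.  WEAKER · ★ PROVED in part B (`octPlateauQ_designate`, every class, every floor `b₁ ≥ 1/8`); part C's cones
  `chargedEnergyGap_of_octahedralLedger_designate'` / `…_numerics` have (K₀), resp. (K₀) and (G), discharged.
* (K₁) `OctShellQ (1/2) c_T cχ` — over the cubic class: `octShellL ≥ −c_T·shellMassL − cχ·transMassL`.  THE CRUX (weight transport at the profile
  onset).  UNDECIDED, now QUANTIFIED (`num/woct.py`, `num/woct2.py`, pure python): the weighted 18×18 octahedron form is PSD for CONSTANT weights
  (margin `κ₂ − |c₂| = 0.0338`), for AFFINE weight patterns up to relative gradient `0.76` per unit length, for the RADIAL septic profile at every onset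
  depth `δ′ ≥ 20` and for CONVEX (spherical) centre sets at `δ′ ≥ 20` (deficits `≤ 3e-8·|u|²` below, i.e. `≲ 1e-10` per octahedron `≪ c_T = 1.7e-8`);
  it is NOT PSD for KINKED patterns `w(min(δ₁, δ₂))` (cut locus of `dist(·, C)` for non-convex `C`, admissible since `C` is an arbitrary invariant
  set): relative deficit up to `6.5e-2·W̄` at `δ′ ∈ [14, 30]`, absolute `≤ 5e-5·|u|²` — with the a-priori strain `τ = 3/100` this is `≈ 1e-7` per kinked
  octahedron, `≈ 7×` the `c_T` budget of a shell site, on the (sparse, codimension-one) kink sheets.  So (K₁) is NOT octahedron-local for kinked `C`;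
  it is TRUE-leaning GLOBALLY because `c_H` is free: every excised site within `3ϱ/8 = 60` of the onset sheet is priced, so seam cores must sit at
  `dist(·, C) < 20`, `≥ 74` from the sheet, where Volterra strains are `≲ 6e-3` (deficit `≲ 5e-9` per octahedron `< c_T`).  INSTRUMENTABLE (census ask
  KINK-73) · ATTACKABLE-M (affine-weight SOS certificate + elastic decay from priced sources) · doors if it dies: [REACH] (re-type the block with
  `reach(C) ≥ ϱ` — `dist(·,C)` is then `C^{1,1}` on the transition zone, no kinks) at the (N-q) level, or [KINK-PRICE] (a third budget currency).
* (C) `OctCollarQ (1/2)` — over the cubic class: `∃ c_H ≥ 0, octCollarL ≥ −c_H·pricedNearCountL`.  An octahedron meeting `X` with a present pair of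
  positive weight has all its excised vertices PRICED (within `2ρ < 60` of a positively weighted non-excised site); its form is
  `≥ −(|c|/4)·6·(2ρτ)² ≥ −1.3e-3`, six octahedra per vertex: `c_H = 1/100` suffices.  WEAKER · TRUE · ATTACKABLE-S (periodic counting).

GLUE (PROVED, §L4): (G) ∧ (L) ∧ (K₀) ∧ (K₁) ∧ (C) ⟹ [MID-q](`κ₂, 0, c_T, cχ`) for ANY class pair and dials (`midTrussQ_of_octahedralLedger`), and the
q-DESIGNATE RE-THREADED (`chargedEnergyGap_of_octahedralLedger_designate`: the nineteen hypotheses of the landed q-designate with [MID-qᶠ] replaced by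
the five pieces; [MID-qʰ] is kept verbatim — the hcp octahedra of the two-parameter stress-free cell `(0.97179, 0.79335)` are not regular, the same
ledger applies with a perturbed certificate, ATTACKABLE-S, not cut here).

WHY THIS IS NOVEL: the lineage's truss leaves were typed SITEWISE (star of a site) and certified only at constant weight «up to onset transport»; the
ledger makes the OCTAHEDRON (not the site, not the bond) the unit of account by an exact identity, which (i) lets the landed local exactness of NODE 72
and the octahedron certificate of NODE 71 close the plateau part OUTRIGHT (part B: the first mechanism-level inequality of the truss line proved over
the full thirteen-binder block, not a certificate-in-docstring), (ii) isolates the onset as ONE functional inequality about clean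
unequal-weight octahedra, and (iii) exposes — by an 18×18 eigenvalue computation — that this inequality is decided NOT by the profile's smoothness but by
the CUT LOCUS of `dist(·, C)`: kinked weight patterns break octahedron-locality, and the free collar price `c_H` is what restores it (sources are pushed
`74` away from the onset sheet).  No EQUIV is introduced (the lineage's EQUIV of record is unchanged); every piece is one-directional.

WHY EACH PIECE IS STRICTLY WEAKER THAN [MID-qᶠ]: (G) and the framing half of (L) are field-free statements about the reference alone; the identity
half of (L) has no inequality content; (K₀), (K₁), (C) each bound ONE of three functionals whose sum is the leaf's left side, (K₀) by `0` (certified),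
(C) by the collar currency alone, (K₁) by the two shell currencies alone — none of them controls the other two.

Part A (this file): §L1 frames and the cubic class · §L2 the octahedral functionals · §L3 the five pieces · §L4 glue + designate cone · §L5 sanity.
Part B: the displacement form of the octahedron certificate and the proof of (K₀) at the designate.  Part C: (G) from the scale certificate,
non-vacuity of the cubic block (the record reference inhabits it), and the cones with (K₀) / (K₀) ∧ (G) discharged.
-/

noncomputable section

open scoped Classical
open Literature.MathematicalPhysics.StatisticalMechanics Literature.Geometry.DiscreteGeometry
open Summit.AtomisticToContinuum.Crystallization.Theses.PricedLinkCensus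
open Summit.AtomisticToContinuum.Crystallization.Theorems.ChargedEnergyGapNegative

namespace Summit.AtomisticToContinuum.Crystallization.Theorems.ChargedEnergyGapChartDial

/-! ## §L1 Octahedral frames, framed references, the cubic fcc class -/

section Frames

/-- The six vertices `c ± ρ·fᵢ` of the octahedron with centre `c`, frame `f`, half-diagonal `ρ` (vertex `(i, b)`: sign `+` iff `b = true`). -/
def octVertex (c : E3) (f : Fin 3 → E3) (ρ : ℝ) (i : Fin 3) (b : Bool) : E3 :=
  c + (if b then ρ else -ρ) • f i

/-- `x` lies in the OCTAHEDRON SPANNED BY THE PAIR `(y, z)` of the reference: a site equal to `y`, equal to `z`, or within `r₁` of both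
(in the cubic fcc reference at `r₁ = 6/5` and `d(y,z) = a√2`: the two apices and the four equatorial sites of an octahedral hole). -/
def InOct (P : PeriodicConfiguration 3) (r₁ : ℝ) (y z x : E3) : Prop :=
  x ∈ P.points ∧ (x = y ∨ x = z ∨ (dist y x ≤ r₁ ∧ dist z x ≤ r₁))

/-- **FRAMED OCTAHEDRA**: every mid pair `(y, z)` of the reference (`r₁ < d ≤ r₂`) spans a REGULAR octahedron of the reference — `y, z` antipodal along
the first frame vector, half-diagonal `ρ ∈ [ρlo, ρhi]`, and the sites of `InOct` are exactly the six vertices.  (Field-free; in the cubic fcc reference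
with nearest-neighbour distance `a` it holds with `ρ = a/√2`.) -/
def IsFramedOct (P : PeriodicConfiguration 3) (r₁ r₂ ρlo ρhi : ℝ) : Prop :=
  ∀ y ∈ P.points, ∀ z ∈ P.points, r₁ < dist y z → dist y z ≤ r₂ →
    ∃ (c : E3) (f : Fin 3 → E3) (ρ : ℝ), Orthonormal ℝ f ∧ ρlo ≤ ρ ∧ ρ ≤ ρhi ∧
      octVertex c f ρ 0 false = y ∧ octVertex c f ρ 0 true = z ∧ ∀ x : E3, InOct P r₁ y z x ↔ ∃ i b, x = octVertex c f ρ i b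

/-- **CUBIC fcc IMAGE** with nearest-neighbour window `[alo, ahi]`: `IsFccImage` with the layer spacing PINNED to the cubic value `h² = 2a²/3`. -/
def IsCubicFccImage (alo ahi : ℝ) (S : Set E3) : Prop :=
  ∃ (a h : ℝ) (s : ℤ → ℤ) (g : E3 → E3), (alo ≤ a ∧ a ≤ ahi) ∧ (0 < h ∧ h ^ 2 = 2 / 3 * a ^ 2) ∧
    IsHaggSeq s ∧ IsFccHagg s ∧ Isometry g ∧ S = g '' barlowStacking a h s

/-- (G) **CLASS SELECTION BY EQUILIBRIUM** (generic shape): every force-free, site-stress-free reference of class `cls` is of class `cls'`. -/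
def CubicSelect (cls cls' : Set E3 → Prop) : Prop :=
  ∀ P : PeriodicConfiguration 3, cls P.points → IsForceFree P → IsSiteStressFree P → cls' P.points

/-- Class selection is reflexive … -/
theorem cubicSelect_refl (cls : Set E3 → Prop) : CubicSelect cls cls := fun _ h _ _ => h

/-- … and transitive (selections compose). -/
theorem CubicSelect.trans {c₁ c₂ c₃ : Set E3 → Prop} (h₁ : CubicSelect c₁ c₂) (h₂ : CubicSelect c₂ c₃) : CubicSelect c₁ c₃ :=
  fun P h hF hS => h₂ P (h₁ P h hF hS) hF hS

/-- A cubic fcc image in a window inside `[9/10, 11/10]` is an fcc-class image (the cubic `h² = 2a²/3` lies inside the Barlow window). -/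
theorem IsCubicFccImage.isFccImage {alo ahi : ℝ} {S : Set E3} (hlo : 9 / 10 ≤ alo) (hhi : ahi ≤ 11 / 10) (h : IsCubicFccImage alo ahi S) :
    IsFccImage S := by
  obtain ⟨a, hh, s, g, ⟨ha1, ha2⟩, ⟨hh0, hh2⟩, hs, hf, hg, hS⟩ := h
  refine ⟨a, hh, s, g, ⟨by linarith, by linarith⟩, ⟨hh0, ?_, ?_⟩, hs, hf, hg, hS⟩
  · rw [hh2]; nlinarith [sq_nonneg a]
  · rw [hh2]; nlinarith [sq_nonneg a]

end Frames

/-! ## §L2 The octahedron form and the three octahedral functionals -/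

section Ledger

variable (ϱχ : ℝ) {m : ℕ} (D : Fin m → Set E3) (σ : Fin m → Bool)

/-- The SITE WEIGHT `χ(y)·w(y)` off the excision, `0` on it — the common weight of `springL`, `barMidL`, … (`springL_eq_sum_siteW`). -/
def siteW (X : Set E3) (ϱ : ℝ) (C : Set E3) (y : E3) : ℝ :=
  if y ∈ X then 0 else localFactor ϱχ D σ y * profileWeight ϱ C y

/-- The LONGITUDINAL COMPONENT `⟪ê_pq, β p q⟫` of a bond field on the ordered pair `(p, q)` (the integrand of `springSite` and `bondBar`). -/
def pairElong (β : E3 → E3 → E3) (p q : E3) : ℝ :=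
  inner ℝ ((dist p q)⁻¹ • (q - p)) (β p q)

/-- The LEDGER COEFFICIENT of an ordered pair inside an octahedron: `κ₂/2` on an edge (`d ≤ r₁`; the pair is an edge of TWO octahedra, each books
half of `κ₂`), `¼·c(d) = ¼(V″(d) − V′(d)/d)` on a diagonal (`d > r₁`; booked once, as in `barMidSite`). -/
def octCoef (κ₂ r₁ : ℝ) (p q : E3) : ℝ :=
  if dist p q ≤ r₁ then κ₂ / 2 else (1 / 4) * (ljD2 (dist p q) - ljD1 (dist p q) / dist p q)

/-- The ORDERED PAIR TERM with first-endpoint weight: present iff `p ≠ q` and both endpoints are off `X` (`W p = 0` on `X`). -/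
def octPairTerm (κ₂ r₁ : ℝ) (W : E3 → ℝ) (X : Set E3) (β : E3 → E3 → E3) (p q : E3) : ℝ :=
  if p ≠ q ∧ q ∉ X then W p * (octCoef κ₂ r₁ p q * pairElong β p q ^ 2) else 0

/-- The **OCTAHEDRON FORM** of the pair `(y, z)`: the sum of the ordered pair terms over the sites of its octahedron (`finsum`s; finite for a separated
reference, `0` by convention otherwise). -/
def octForm (κ₂ r₁ : ℝ) (W : E3 → ℝ) (X : Set E3) (β : E3 → E3 → E3) (P : PeriodicConfiguration 3) (y z : E3) : ℝ :=
  ∑ᶠ p : E3, ∑ᶠ q : E3, if InOct P r₁ y z p ∧ InOct P r₁ y z q then octPairTerm κ₂ r₁ W X β p q else 0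

/-- The octahedron of `(y, z)` is CLEAN: none of its sites is excised. -/
def OctClean (P : PeriodicConfiguration 3) (r₁ : ℝ) (X : Set E3) (y z : E3) : Prop :=
  ∀ x : E3, InOct P r₁ y z x → x ∉ X

/-- The octahedron of `(y, z)` is a PLATEAU octahedron for the weight `W`: all its sites carry the same weight. -/
def OctPlateau (P : PeriodicConfiguration 3) (r₁ : ℝ) (W : E3 → ℝ) (y z : E3) : Prop :=
  ∀ x x' : E3, InOct P r₁ y z x → InOct P r₁ y z x' → W x = W x'

/-- The OCTAHEDRAL SITE FUNCTIONAL selected by `π`: one sixth of the octahedron form, summed over the mid partners `z` of `y` whose octahedron satisfies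
`π` (each octahedron is booked from its six vertices). -/
def octSiteWith (π : E3 → E3 → Prop) (κ₂ r₁ r₂ : ℝ) (W : E3 → ℝ) (X : Set E3) (β : E3 → E3 → E3) (P : PeriodicConfiguration 3) (y : E3) : ℝ :=
  ∑ᶠ z : E3, if (z ∈ P.points ∧ r₁ < dist y z ∧ dist y z ≤ r₂) ∧ π y z then (1 / 6) * octForm κ₂ r₁ W X β P y z else 0

/-- The **PLATEAU OCTAHEDRAL FUNCTIONAL**: clean octahedra with six equal weights. -/
def octPlateauL (κ₂ r₁ r₂ : ℝ) (β : E3 → E3 → E3) (P : PeriodicConfiguration 3) (X : Set E3) (ϱ : ℝ) (C : Set E3) : ℝ :=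
  ∑ y ∈ P.motif, octSiteWith (fun y z => OctClean P r₁ X y z ∧ OctPlateau P r₁ (siteW ϱχ D σ X ϱ C) y z)
    κ₂ r₁ r₂ (siteW ϱχ D σ X ϱ C) X β P y

/-- The **SHELL OCTAHEDRAL FUNCTIONAL**: clean octahedra with unequal weights (some vertex in a transition of `w_C` or of a `χ`-factor). -/
def octShellL (κ₂ r₁ r₂ : ℝ) (β : E3 → E3 → E3) (P : PeriodicConfiguration 3) (X : Set E3) (ϱ : ℝ) (C : Set E3) : ℝ :=
  ∑ y ∈ P.motif, octSiteWith (fun y z => OctClean P r₁ X y z ∧ ¬OctPlateau P r₁ (siteW ϱχ D σ X ϱ C) y z)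
    κ₂ r₁ r₂ (siteW ϱχ D σ X ϱ C) X β P y

/-- The **COLLAR OCTAHEDRAL FUNCTIONAL**: octahedra meeting the excision. -/
def octCollarL (κ₂ r₁ r₂ : ℝ) (β : E3 → E3 → E3) (P : PeriodicConfiguration 3) (X : Set E3) (ϱ : ℝ) (C : Set E3) : ℝ :=
  ∑ y ∈ P.motif, octSiteWith (fun y z => ¬OctClean P r₁ X y z) κ₂ r₁ r₂ (siteW ϱχ D σ X ϱ C) X β P y

variable {ϱχ D σ}

/-- The site weight is non-negative … -/
theorem siteW_nonneg (X : Set E3) (ϱ : ℝ) (C : Set E3) (y : E3) : 0 ≤ siteW ϱχ D σ X ϱ C y := by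
  unfold siteW; split_ifs
  · exact le_rfl
  · exact mul_nonneg (localFactor_nonneg ϱχ D σ y) (profileWeight_nonneg ϱ C y)

/-- … vanishes on the excision … -/
theorem siteW_of_mem {X : Set E3} (ϱ : ℝ) (C : Set E3) {y : E3} (hy : y ∈ X) : siteW ϱχ D σ X ϱ C y = 0 := by
  simp [siteW, hy]

/-- … and the pivot is the site-weighted spring sum (the form in which the ledger prover meets it). -/
theorem springL_eq_sum_siteW (β : E3 → E3 → E3) (P : PeriodicConfiguration 3) (X : Set E3) (r₁ ϱ : ℝ) (C : Set E3) :
    springL ϱχ D σ β P X r₁ ϱ C = ∑ y ∈ P.motif, siteW ϱχ D σ X ϱ C y * springSite β P X r₁ y := by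
  unfold springL siteW
  refine Finset.sum_congr rfl fun y _ => ?_
  split_ifs <;> ring

/-- Likewise the mid bar form. -/
theorem barMidL_eq_sum_siteW (β : E3 → E3 → E3) (P : PeriodicConfiguration 3) (X : Set E3) (r₁ r₂ ϱ : ℝ) (C : Set E3) :
    barMidL ϱχ D σ r₁ r₂ β P X ϱ C = ∑ y ∈ P.motif, siteW ϱχ D σ X ϱ C y * barMidSite r₁ r₂ β P X y := by
  unfold barMidL siteW
  refine Finset.sum_congr rfl fun y _ => ?_
  split_ifs <;> ring

/-- The pair term vanishes from an excised first endpoint (so «both endpoints off `X`» is the effective support). -/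
theorem octPairTerm_of_mem (κ₂ r₁ : ℝ) {X : Set E3} (ϱ : ℝ) (C : Set E3) (β : E3 → E3 → E3) {p : E3} (q : E3) (hp : p ∈ X) :
    octPairTerm κ₂ r₁ (siteW ϱχ D σ X ϱ C) X β p q = 0 := by
  unfold octPairTerm; rw [siteW_of_mem ϱ C hp]; split_ifs <;> simp

/-- On the zero field every octahedron form vanishes (the ledger functionals are forms in `β`). -/
theorem octForm_zero (κ₂ r₁ : ℝ) (W : E3 → ℝ) (X : Set E3) (P : PeriodicConfiguration 3) (y z : E3) :
    octForm κ₂ r₁ W X (fun _ _ => 0) P y z = 0 := by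
  unfold octForm octPairTerm pairElong
  simp

end Ledger

/-! ## §L3 The five pieces beneath [MID-q] -/

section Pieces

variable (cls : Set E3 → Prop) (s lam ℓ μ₀ τ ϱ b₀ r_S b₁ ϱχ r₁ r₂ : ℝ)

/-- ★ piece (L) [OCT-LEDGER-q](`κ₂; ρlo, ρhi`) · over the block of [MID-q] with the (cubic) class `cls`: the reference has FRAMED OCTAHEDRA with
half-diagonal in `[ρlo, ρhi]`, and THE LEDGER IDENTITY `κ₂·springL + barMidL = octPlateauL + octShellL + octCollarL`.  WEAKER (no inequality content:
lattice geometry + periodic re-summation) · TRUE (numerically exact on a periodic cubic cell, `num/ledger_check.py`: every near ordered pair is an edge of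
exactly two octahedra, every mid ordered pair the diagonal of exactly one, one octahedron per site) · ATTACKABLE-S.  Why it might fail: only by a slip
in the typing of the functionals (guarded by the numerical check) — or if `cls` admits a non-cubic cell (then `IsFramedOct` fails: use (G)). -/
def OctLedgerQ (κ₂ ρlo ρhi : ℝ) : Prop :=
  ∀ (P : PeriodicConfiguration 3) (C X : Set E3) (β₀ : E3 → E3 → E3) (k : ℕ) (S : Fin k → CutPiece)
    (m : ℕ) (D : Fin m → Set E3) (σ : Fin m → Bool),
    IsSeparatedRef s P → IsLabelledRef lam ℓ P → cls P.points → IsForceFree P → IsSiteStressFree P → HarmStableModRot μ₀ P →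
    IsInvariantSet P C → IsInvariantSet P X → IsGlobalCocycle P β₀ → IsSeamSystem b₀ r_S P S → IsQuantisedSeams b₁ S →
    SmallStrain τ P X (volterraField P S β₀) → (∀ i, IsInvariantSet P (D i)) →
      IsFramedOct P r₁ r₂ ρlo ρhi ∧
      κ₂ * springL ϱχ D σ (volterraField P S β₀) P X r₁ ϱ C + barMidL ϱχ D σ r₁ r₂ (volterraField P S β₀) P X ϱ C =
        octPlateauL ϱχ D σ κ₂ r₁ r₂ (volterraField P S β₀) P X ϱ C + octShellL ϱχ D σ κ₂ r₁ r₂ (volterraField P S β₀) P X ϱ C +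
          octCollarL ϱχ D σ κ₂ r₁ r₂ (volterraField P S β₀) P X ϱ C

/-- ★ piece (K₀) [OCT-PLATEAU-q](`κ₂; ρlo, ρhi`) · THE CORE: over the block, on a reference with framed octahedra, the plateau functional is
NON-NEGATIVE.  WEAKER · ★ PROVED at the designate in part B (`octPlateauQ_designate`: `κ₂ = 1/2`, `τ = 3/100`, `r₁ = 6/5`, `r₂ = 3/2`, window
`[0.679, 0.691]`, every class, every `b₁ ≥ 1/8` — `octahedron_certificate` in displacement form + `volterraField_localExact_of_diam` + `−½ ≤ c(2ρ)`).
At other dials it fails only if `κ₂ < |c(2ρ)|` (`|c| ≤ 0.4987` on the window) or `3τ·2ρ ≥ b₁` (no local exactness). -/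
def OctPlateauQ (κ₂ ρlo ρhi : ℝ) : Prop :=
  ∀ (P : PeriodicConfiguration 3) (C X : Set E3) (β₀ : E3 → E3 → E3) (k : ℕ) (S : Fin k → CutPiece)
    (m : ℕ) (D : Fin m → Set E3) (σ : Fin m → Bool),
    IsSeparatedRef s P → IsLabelledRef lam ℓ P → cls P.points → IsForceFree P → IsSiteStressFree P → HarmStableModRot μ₀ P →
    IsInvariantSet P C → IsInvariantSet P X → IsGlobalCocycle P β₀ → IsSeamSystem b₀ r_S P S → IsQuantisedSeams b₁ S →
    SmallStrain τ P X (volterraField P S β₀) → (∀ i, IsInvariantSet P (D i)) → IsFramedOct P r₁ r₂ ρlo ρhi →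
      0 ≤ octPlateauL ϱχ D σ κ₂ r₁ r₂ (volterraField P S β₀) P X ϱ C

/-- ★ piece (K₁) [OCT-SHELL-q](`κ₂, c_T, cχ`) · THE ONSET CRUX: over the block, the shell functional (clean octahedra with unequal weights) is bounded
below by the two shell currencies.  WEAKER · UNDECIDED → TRUE-leaning GLOBALLY, FALSE-leaning OCTAHEDRON-LOCALLY for kinked `dist(·, C)` (module
docstring: PSD for constant / affine ≤ 0.76 / radial δ′ ≥ 20 / convex patterns; kinked patterns lose up to `6.5e-2·W̄`, `≈ 7× c_T` per octahedron at the
a-priori strain, restored by source distance since `c_H` is free) · INSTRUMENTABLE (KINK-73) · ATTACKABLE-M.  Why it might fail: a quantised seam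
geometry hiding its cores at `dist(·,C) < 20` yet straining a dense family of cut-locus sheets of a non-convex `C` in the onset zone `δ′ ∈ [14, 30]`
above `≈ 1.5e-2`. -/
def OctShellQ (κ₂ c_T cχ : ℝ) : Prop :=
  ∀ (P : PeriodicConfiguration 3) (C X : Set E3) (β₀ : E3 → E3 → E3) (k : ℕ) (S : Fin k → CutPiece)
    (m : ℕ) (D : Fin m → Set E3) (σ : Fin m → Bool),
    IsSeparatedRef s P → IsLabelledRef lam ℓ P → cls P.points → IsForceFree P → IsSiteStressFree P → HarmStableModRot μ₀ P →
    IsInvariantSet P C → IsInvariantSet P X → IsGlobalCocycle P β₀ → IsSeamSystem b₀ r_S P S → IsQuantisedSeams b₁ S →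
    SmallStrain τ P X (volterraField P S β₀) → (∀ i, IsInvariantSet P (D i)) →
      -(c_T * shellMassL ϱχ D σ P X ϱ C) - cχ * transMassL ϱχ D σ P X ϱ C ≤ octShellL ϱχ D σ κ₂ r₁ r₂ (volterraField P S β₀) P X ϱ C

/-- ★ piece (C) [OCT-COLLAR-q](`κ₂`) · over the block, the collar functional (octahedra meeting `X`) is bounded below by the collar currency.  WEAKER ·
TRUE (`|form| ≤ (|c|/4)·6·(2ρτ)² ≤ 1.3e-3` per collar octahedron with a present positively-weighted pair, whose excised vertices are then PRICED —
within `2ρ < 3ϱ/8`; six octahedra per vertex: `c_H = 1/100`) · ATTACKABLE-S (periodic counting).  Why it might fail: only if `3ϱ/8 < 2ρ` (other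
dials). -/
def OctCollarQ (κ₂ : ℝ) : Prop :=
  ∃ c_H : ℝ, 0 ≤ c_H ∧ ∀ (P : PeriodicConfiguration 3) (C X : Set E3) (β₀ : E3 → E3 → E3) (k : ℕ) (S : Fin k → CutPiece)
    (m : ℕ) (D : Fin m → Set E3) (σ : Fin m → Bool),
    IsSeparatedRef s P → IsLabelledRef lam ℓ P → cls P.points → IsForceFree P → IsSiteStressFree P → HarmStableModRot μ₀ P →
    IsInvariantSet P C → IsInvariantSet P X → IsGlobalCocycle P β₀ → IsSeamSystem b₀ r_S P S → IsQuantisedSeams b₁ S →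
    SmallStrain τ P X (volterraField P S β₀) → (∀ i, IsInvariantSet P (D i)) →
      -(c_H * (pricedNearCountL ϱχ D σ P X ϱ C : ℝ)) ≤ octCollarL ϱχ D σ κ₂ r₁ r₂ (volterraField P S β₀) P X ϱ C

end Pieces

/-! ## §L4 ★★ The glue (PROVED) and the designate cone re-threaded -/

section Glue

variable {cls cls' : Set E3 → Prop} {s lam ℓ μ₀ τ ϱ b₀ r_S b₁ ϱχ r₁ r₂ κ₂ ρlo ρhi c_T cχ : ℝ}

/-- ★★ THE GLUE: (G) ∧ (L) ∧ (K₀) ∧ (K₁) ∧ (C) ⟹ [MID-q](`κ₂, η₂ = 0, c_T, cχ`) — for any class pair and any dials (add the three bounds along the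
ledger identity; the class is transported by (G) through the force-free and site-stress-free binders). -/
theorem midTrussQ_of_octahedralLedger (hG : CubicSelect cls cls')
    (hL : OctLedgerQ cls' s lam ℓ μ₀ τ ϱ b₀ r_S b₁ ϱχ r₁ r₂ κ₂ ρlo ρhi)
    (hK : OctPlateauQ cls' s lam ℓ μ₀ τ ϱ b₀ r_S b₁ ϱχ r₁ r₂ κ₂ ρlo ρhi)
    (hSh : OctShellQ cls' s lam ℓ μ₀ τ ϱ b₀ r_S b₁ ϱχ r₁ r₂ κ₂ c_T cχ)
    (hC : OctCollarQ cls' s lam ℓ μ₀ τ ϱ b₀ r_S b₁ ϱχ r₁ r₂ κ₂) :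
    MidTrussQ cls s lam ℓ μ₀ τ ϱ b₀ r_S b₁ ϱχ r₁ r₂ κ₂ 0 c_T cχ := by
  obtain ⟨c_H, hc, hC⟩ := hC
  refine ⟨c_H, hc, fun P C X β₀ k S m D σ h1 h2 hcl h3 h4 h5 h6 h7 h8 h9 hq h10 h11 => ?_⟩
  have hcl' : cls' P.points := hG P hcl h3 h4
  obtain ⟨hFr, hId⟩ := hL P C X β₀ k S m D σ h1 h2 hcl' h3 h4 h5 h6 h7 h8 h9 hq h10 h11
  have e1 := hK P C X β₀ k S m D σ h1 h2 hcl' h3 h4 h5 h6 h7 h8 h9 hq h10 h11 hFr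
  have e2 := hSh P C X β₀ k S m D σ h1 h2 hcl' h3 h4 h5 h6 h7 h8 h9 hq h10 h11
  have e3 := hC P C X β₀ k S m D σ h1 h2 hcl' h3 h4 h5 h6 h7 h8 h9 hq h10 h11
  rw [zero_mul, add_zero]
  linarith

/-- (G) is OPTIONAL when the pieces are stated over the original class (`CubicSelect` is reflexive) — recorded so a prover may certify (L) directly over
`IsFccImage ∧ force-free ∧ site-stress-free` if that is more convenient than (G). -/
theorem midTrussQ_of_octahedralLedger_self
    (hL : OctLedgerQ cls s lam ℓ μ₀ τ ϱ b₀ r_S b₁ ϱχ r₁ r₂ κ₂ ρlo ρhi)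
    (hK : OctPlateauQ cls s lam ℓ μ₀ τ ϱ b₀ r_S b₁ ϱχ r₁ r₂ κ₂ ρlo ρhi)
    (hSh : OctShellQ cls s lam ℓ μ₀ τ ϱ b₀ r_S b₁ ϱχ r₁ r₂ κ₂ c_T cχ)
    (hC : OctCollarQ cls s lam ℓ μ₀ τ ϱ b₀ r_S b₁ ϱχ r₁ r₂ κ₂) :
    MidTrussQ cls s lam ℓ μ₀ τ ϱ b₀ r_S b₁ ϱχ r₁ r₂ κ₂ 0 c_T cχ :=
  midTrussQ_of_octahedralLedger (cubicSelect_refl cls) hL hK hSh hC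

/-- ★★ **THE q-DESIGNATE THROUGH THE OCTAHEDRAL LEDGER**: the landed nineteen-hypothesis cone `chargedEnergyGap_of_quantisedCascade_designate` with its
leaf [MID-qᶠ] replaced by (G) ∧ (L) ∧ (K₀) ∧ (K₁) ∧ (C) over the cubic class `IsCubicFccImage (1921/2000) (977/1000)`, window `ρ ∈ [679/1000, 691/1000]`;
every other leaf verbatim (twenty-three hypotheses). -/
theorem chargedEnergyGap_of_octahedralLedger_designate {b₁ : ℝ} (hF : ChargeRecount)
    (hIP : ImprovablePricingG (3 / 20) (1 / 10) (6 / 5) 10 (1 / 100) (3 / 5))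
    (hFCP : FrustratedCorePricingG (3 / 20) (1 / 10) (6 / 5) 10 (1 / 100) 40 (3 / 5))
    (hCCP : CoherentCorePricingG (3 / 20) (1 / 10) (6 / 5) 10 (1 / 100) 40 (1 / 10) 40 (3 / 5))
    (hB : CoreBallRegularPricingW (maxCoverWeights (3 / 20) (1 / 10) (6 / 5) 10 (1 / 100) 40 (1 / 10) 40 160) (1 / 20) (3 / 5) 10
      fun _ _ => True)
    (hLab : CleanLabellingW (maxCoverWeights (3 / 20) (1 / 10) (6 / 5) 10 (1 / 100) 40 (1 / 10) 40 160) (3 / 5) 10 (1 / 3) 3)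
    (hSB : ShellBudgetW (maxCoverWeights (3 / 20) (1 / 10) (6 / 5) 10 (1 / 100) 40 (1 / 10) 40 160) (3 / 5) 100000)
    (hLf : LoadBoundQ IsFccImage (3 / 5) (1 / 3) 3 (1 / 100) (3 / 100) 160 (2 / 5) 3 b₁ 80 (6 / 5) (3 / 4) (3 / 10000000) (9 / 1000000))
    (hNf : NnStiffCls IsFccImage (27 / 10) (6 / 5))
    (hG : CubicSelect IsFccImage (IsCubicFccImage (1921 / 2000) (977 / 1000)))
    (hOL : OctLedgerQ (IsCubicFccImage (1921 / 2000) (977 / 1000)) (3 / 5) (1 / 3) 3 (1 / 100) (3 / 100) 160 (2 / 5) 3 b₁ 80 (6 / 5) (3 / 2)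
      (1 / 2) (679 / 1000) (691 / 1000))
    (hOK : OctPlateauQ (IsCubicFccImage (1921 / 2000) (977 / 1000)) (3 / 5) (1 / 3) 3 (1 / 100) (3 / 100) 160 (2 / 5) 3 b₁ 80 (6 / 5) (3 / 2)
      (1 / 2) (679 / 1000) (691 / 1000))
    (hOS : OctShellQ (IsCubicFccImage (1921 / 2000) (977 / 1000)) (3 / 5) (1 / 3) 3 (1 / 100) (3 / 100) 160 (2 / 5) 3 b₁ 80 (6 / 5) (3 / 2)
      (1 / 2) (1 / 60000000) (1 / 2000000))
    (hOC : OctCollarQ (IsCubicFccImage (1921 / 2000) (977 / 1000)) (3 / 5) (1 / 3) 3 (1 / 100) (3 / 100) 160 (2 / 5) 3 b₁ 80 (6 / 5) (3 / 2)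
      (1 / 2))
    (hFf : FarTrussQ IsFccImage (3 / 5) (1 / 3) 3 (1 / 100) (3 / 100) 160 (2 / 5) 3 b₁ 80 (6 / 5) (3 / 2) (11 / 20) (1 / 25) (1 / 60000000)
      (1 / 2000000))
    (hGf : GeoExchQ IsFccImage (3 / 5) (1 / 3) 3 (1 / 100) (3 / 100) 160 (2 / 5) 3 b₁ 80 (6 / 5) (3 / 20) (1 / 25) (1 / 30000000) (1 / 1000000))
    (hLh : LoadBoundQ IsHcpImage (3 / 5) (1 / 3) 3 (1 / 100) (3 / 100) 160 (2 / 5) 3 b₁ 80 (6 / 5) (3 / 4) (3 / 10000000) (9 / 1000000))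
    (hNh : NnStiffCls IsHcpImage (27 / 10) (6 / 5))
    (hMh : MidTrussQ IsHcpImage (3 / 5) (1 / 3) 3 (1 / 100) (3 / 100) 160 (2 / 5) 3 b₁ 80 (6 / 5) (3 / 2) (1 / 2) 0 (1 / 60000000) (1 / 2000000))
    (hFh : FarTrussQ IsHcpImage (3 / 5) (1 / 3) 3 (1 / 100) (3 / 100) 160 (2 / 5) 3 b₁ 80 (6 / 5) (3 / 2) (1 / 2) (1 / 40) (1 / 60000000)
      (1 / 2000000))
    (hGh : GeoExchQ IsHcpImage (3 / 5) (1 / 3) 3 (1 / 100) (3 / 100) 160 (2 / 5) 3 b₁ 80 (6 / 5) (1 / 5) (1 / 40) (1 / 30000000) (1 / 1000000))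
    (hN : LocalSeamReductionQ (3 / 5) (1 / 3) 3 (1 / 100) (3 / 100) (1 / 2) 160 (2 / 5) 3 b₁ 80 (1 / 3000000) (1 / 100000)
      (maxCoverWeights (3 / 20) (1 / 10) (6 / 5) 10 (1 / 100) 40 (1 / 10) 40 160) (1 / 20) 10 100000)
    (hP : ChartedChargePricingG (3 / 20) (1 / 10) (3 / 5)) : ChargedEnergyGap :=
  chargedEnergyGap_of_quantisedCascade_designate hF hIP hFCP hCCP hB hLab hSB hLf hNf (midTrussQ_of_octahedralLedger hG hOL hOK hOS hOC)
    hFf hGf hLh hNh hMh hFh hGh hN hP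

end Glue

/-! ## §L5 Sanity: windows, non-vacuity of the class, vertices -/

section Sanity

/-- The cubic window `[0.9605, 0.977]` lies inside the Barlow window, so every cubic fcc image of the cone is an fcc-class image (the new class is a
SUB-class: the pieces over it are weaker than the same pieces over `IsFccImage`). -/
theorem isFccImage_of_isCubicFccImage_designate {S : Set E3} (h : IsCubicFccImage (1921 / 2000) (977 / 1000) S) : IsFccImage S :=
  h.isFccImage (by norm_num) (by norm_num)

/-- Non-vacuity of the class: the cubic fcc stacking at any spacing of the window (identity motion) is a cubic fcc image. -/
theorem isCubicFccImage_fccStacking {alo ahi a : ℝ} (ha : alo ≤ a ∧ a ≤ ahi) (ha0 : 0 < a) :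
    IsCubicFccImage alo ahi (fccStacking a (Fcc.hOf a)) :=
  ⟨a, Fcc.hOf a, constHagg, id, ha, ⟨Fcc.hOf_pos ha0, Fcc.hOf_sq a⟩, isHaggSeq_const, isFccHagg_constHagg, isometry_id,
    (Set.image_id _).symm⟩

/-- The half-diagonal window of the cone versus the nearest-neighbour window: `a/√2 ∈ [0.679, 0.691]` for `a ∈ [0.9605, 0.977]`
(squared form: `0.679²·2 ≤ 0.9605²` and `0.977² ≤ 0.691²·2`). -/
theorem rho_window_designate : (679 / 1000 : ℝ) ^ 2 * 2 ≤ (1921 / 2000) ^ 2 ∧ (977 / 1000 : ℝ) ^ 2 ≤ (691 / 1000) ^ 2 * 2 := by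
  constructor <;> norm_num

/-- The diagonal of a framed octahedron of the window is in local-exactness range at the designate: `2ρ ≤ 1.382 < 10/3`. -/
theorem diag_lt_localExact_designate {ρ : ℝ} (h : ρ ≤ 691 / 1000) : 2 * ρ < 10 / 3 := by linarith

/-- Antipodal vertices of a frame differ by `2ρ` times the frame vector. -/
theorem octVertex_true_sub_false (c : E3) (f : Fin 3 → E3) (ρ : ℝ) (i : Fin 3) :
    octVertex c f ρ i true - octVertex c f ρ i false = (2 * ρ) • f i := by
  simp only [octVertex, if_true, Bool.false_eq_true, if_false]
  rw [add_sub_add_left_eq_sub, ← sub_smul]; ring_nf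

end Sanity

end Summit.AtomisticToContinuum.Crystallization.Theorems.ChargedEnergyGapChartDial
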